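import Literature.MathematicalPhysics.QuantumFieldTheory.Balaban1983to89.B10Eq27AxialLog
import Literature.MathematicalPhysics.QuantumFieldTheory.Balaban1983to89.T4Covariance

/-!
# `Balaban1983to89.B10Eq27TorusAxialLog` — [Balaban1985UV3] p. 263, displays **(27)–(28)** ON THE TORUS CARRIER OF RECORD:
# `B(c) = (1/i) log V(Γ_{y,c₋} ∪ c ∪ Γ_{c₊,y})` for the bonds `c` of `□₁ ∩ T^{(1)}` WITH BODY on `Setup`'s torus `Site P j` / `GaugeField P j`,
# and `|B(c)| < 4L²|c₋ − y|g₀p(g₀) < 8L²·3R₁M₁r(g₀)g₀p(g₀)` from the plaquette restrictions (13) near `□₁`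

T. Bałaban, *Ultraviolet stability of three-dimensional lattice pure gauge field theories*, Commun. Math. Phys. **102**, 255–275
(1985) [Balaban1985UV3] (cell paper B10; held `paper:balaban1985-cmp102-uv-stability-3d`, journal page = PDF page + 254; p. 263 =
[PDF 9] re-read 2026-08-23 on the text layer `p0009.txt` and on the render
`run/shared/lean/pub/pub-balaban/b2b-balaban-ref1/pages/1985-cmp102-uv-stability-3d/…-p009-x2.png`; p. 258 = [PDF 4], p. 259 = [PDF 5]);
T. Bałaban, *Averaging operations for lattice gauge theories*, Commun. Math. Phys. **98**, 17–51 (1985) [Balaban1985Averaging] (= B10's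
reference [4]; (8), (9) pp. 18–19, the comb contours and the axial gauge p. 24).  «…» = verbatim.

HONEST FRAMING (mega-formalization `lit-balaban`, verbatim): statement-level skeleton of published theorems with citation tags; proofs
where landed; nothing here is a claim about the Yang–Mills mass gap.

## The printed text (p. 263 [PDF 9])

«We apply the constructions and results of Sect. F [7]. According to these there exists a gauge transformation in a neighbourhood of □₁,
where □₁ is a cube of the size 3RM₁ and with the same center as □, such that the gauge transformed U₁ is represented as exp i𝓗(B) in the
neighbourhood of □₁. … Let us explain now the configuration B, which plays an important role in our considerations. Let y denote the
center of □. The configuration B restricted to □₁ is defined on □₁^{(1)} = □₁ ∩ T^{(1)} and for a bond c of this set is given by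
B(c) = (1/i) log V(Γ_{y,c₋} ∪ c ∪ Γ_{c₊,y}).  (27)
The characteristic functions χ₁ defined in (13) give the restrictions |V(∂p′) − 1| < 2L²g₀p(g₀), hence
|B(c)| < 4L²|c₋ − y|g₀p(g₀) < 8L²3R₁M₁r(g₀)g₀p(g₀),  (28)
and for g₀ sufficiently small the number on the right-hand side above is small.»  The contours: p. 258 [PDF 4], (9) «δ_{Ax(y)}(U) =
∏_{x∈B(y),x≠y} δ(U(Γ_{y,x}))» and (12) «U satisfies axial gauge conditions on Ω₁», with [Balaban1985Averaging] p. 24 «Γ_{y,x} =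
[y, (y₁, …, y_{d−1}, x_d)] ∪ … ∪ [(y₁, x₂, …, x_d), x]» (the coordinates changed one at a time in the order d, …, 1); (13) p. 259 [PDF 5]
«χ₁ = ∏_{p′∈Ω₁^{(1)}} χ({|V(∂p′) − 1| < 2L²g₀p(g₀)})».

## Why this file exists (unit `lit-balaban-r07`, reader/typer and fold owner of B10; gen 54; rows B10.Eq27, B10.Eq28)

The cell file `…B10Eq27AxialLog` (b10 lineage) TYPES (27) and PROVES (28) — and the self-adjointness of `B`, the representation
`V^{v₀} = exp iB`, the residual covariance — for MODEL configurations `V : ℤ^d → Fin d → 𝔸ˣ` on the infinite lattice `ℤ^d` with the comb contours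
of b07's `B7Prop1Explicit`.  The fold owner's DEFINITION-DISPLAY AUDIT of row B10.Eq27 (ROWS-B10 v1.103, lead's READING RULE (a)–(d),
2026-08-23) recorded: «(a) not met in the rule's sense (model carrier; print's instance not identified by a kernel theorem at the consumption
site (28)/(29)/(43)) … OWED: the torus instance».  Print's carrier is the TORUS `T^{(1)}` (in general `T^{(j)}`), the tree's `Setup.Site P j` with
gauge fields `GaugeField P j G = PBond P j → G` — the carrier of rows B10.Eq2 (`B10Eq2DensityTower`), B10.Eq38–Eq40 (`B10Eq38TorusDomains`) and of
(13)/(4) as typed (`Setup.PlaqSmallOn`, `B10Eq2DensityTower.chi4`: `dist1 (plaqHol V p′) < …`).  This file puts (27)–(28) THERE: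

* §1 the dictionary torus ↔ `ℤ^d`: integer translates `transl y z = y + z`, the PERIODIC PULLBACK `pull V y = V♯_y` of a torus configuration to
  the universal cover based at `y`, torus word transport `holT V x w` ((9) of [4]) with `hol V♯_y z w = holT V (y + z) w` (`hol_pull`), the gauge
  action `gaugeActT` ((8) of [4]) and the plaquette word; bridge to the pub-balaban cell's `T4Continuum.holAt ∘ walk` (`holT_eq_holAt`) and to
  `Setup`'s `GaugeField.plaqHol` / `gaugeAct` (`holT_plaqWord_eq_plaqHol`, `hol_pull_plaqWord`, `gaugeActT_eq_gaugeAct`);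
* §2 the relative position `rel y x = x − y ∈ ℤ^d` (least-absolute-value representatives, `ZMod.valMinAbs`): `y + (x − y) = x`, the symmetric
  window, and NO WRAP-AROUND `rel y (x + e_μ) = rel y x + e_μ` whenever `2((x − y)_μ + 1) ≤ period` (`rel_shift_of_le`);
* §3 **(27) WITH BODY ON THE TORUS**: the word `contourT y c = Γ_{y,c₋} ++ [c] ++ (Γ_{y,c₊})⁻¹` (the comb `treeWord` of [4] p. 24 at the relative
  positions), the torus axial gauge transformation `axialT V y x = V(Γ_{y,x})` of (9)/(12), and `B27T V y c := (1/i) log (holT V y (contourT y c))`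
  — PRINT'S FORMULA VERBATIM ON `T^{(j)}` — with the transfer `B27T_eq_B27_pull : B27T V y c = B27 V♯_y 0 (c₋ − y) μ`, (M1) `V(Γ_{y,c₋} ∪ c ∪ Γ_{c₊,y}) =
  v₀(c₋) V(c) v₀(c₊)⁻¹ = (V^{v₀})(c)` (`holT_contourT`, `holT_contourT_eq_gaugeActT`), `exp(iB(c)) = V(Γ…)` (`exp_I_smul_B27T`), covariance
  `B_{V^u}(c) = u(y)B_V(c)u(y)⁻¹` (`B27T_gaugeAct`, the mechanism of (31) p. 264);
* §4 **(28) ON THE TORUS** from (13) assumed for the plaquettes `⟨y + z; κ, μ⟩`, `z` in an integer box `[lo, hi] ∋ 0` covering `□₁` and its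
  next layer (print: `Ω₁^{(1)}`, a neighbourhood of `□₁`): `‖V(Γ…) − 1‖ ≤ |c₋ − y|₁·α` (`norm_holT_contourT_sub_one_le`, b07's clamped non-abelian
  Stokes ladder through the cell file's `…_local` theorems), `‖B(c)‖ ≤ 2|c₋ − y|₁α` (`norm_B27T_le`), the representation `(V^{v₀})(c) = exp iB(c)`
  (`gaugeAct_axialT_eq_exp`), the first member `‖B(c)‖ ≤ 4L²|c₋ − y|₁g₀p(g₀)` (`eq28T_first`) and BOTH PRINTED MEMBERS in `d = 3` for `c₋` in the cube
  of side `3RM₁ = 3R₁r(g₀)M₁` centred at `y` under «g₀ sufficiently small» = `8L²·3R₁M₁r(g₀)·g₀p(g₀) ≤ 1` (`eq28T_print`); flat ⇒ `B = 0`;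
* §5 unitary-valued `V` (every closed `G ≤ U(𝔸)`, `𝔸` a C⋆-algebra): `B(c)` SELF-ADJOINT (`B27T_mem_selfAdjoint` — the `𝔤`-valuedness of (27)),
  `exp iB(c)` unitary;
* §6 **THE CELL'S `U(N)`**: for `V : GaugeField P j (Matrix.unitaryGroup (Fin N) ℂ)` (instance `UnitaryModel.instGaugeGroupUnitaryGroup`, `dist1 W =
  ‖W − 1‖_op`) the hypothesis of §4 IS (13) as typed in the cell, `‖V♯(∂(y + z; κ, μ)) − 1‖ = dist1 (plaqHol V p′)`
  (`norm_holT_unitsField_plaqWord_sub_one`, both orientations `h13_unitsField`), whence `eq28T_unitaryGroup`: (28) both members + `B(c)`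
  Hermitian, from `dist1 (plaqHol V p′) ≤ 2L²g₀p(g₀)` on the plaquettes near `□₁`;
* §7 non-vacuity: `V ≡ 1` has `B ≡ 0`;
* §8 (v1.1, APPEND-ONLY — §1–§7 byte-identical) **THE SEMI-SIMPLE MODEL `SU(N)` OF THEOREM 1**: the inclusion `suIncl : SU(N) →* U(N)`, the included
  field `toUField`, `dist1_plaqHol_toUField` ((13) reads the same), `eq28T_specialUnitaryGroup` ((27)–(28) for `SU(N)`-valued torus fields).

DICTIONARY print ↦ Lean: `T^{(1)}` (in general `T^{(j)}`) ↦ `Site P j`, bonds `c = ⟨c₋, c₋ + e_μ⟩` ↦ `c : PBond P j` (`c.src`, `c.dir`, `c.tgt`);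
`V` ↦ `V : GaugeField P j 𝔸ˣ` (§6: `Matrix.unitaryGroup (Fin N) ℂ`, read in `M_N(ℂ)ˣ` by `unitsField`); `y` (centre of `□ ∋ X`) ↦ `y : Site P j`;
`c₋ − y` ↦ `rel y c.src : Fin d → ℤ`; `|c₋ − y|` ↦ the `ℓ¹` length `l1 (rel y c.src)` (b07); `Γ_{y,x}` ↦ `treeWord (rel y x)` walked from `y`;
`V(Γ)` ↦ `holT V y Γ`; `(1/i) log` ↦ `(-Complex.I) • MatrixLog.mlog`; `□₁` (cube of side `3RM₁` centred at `y`) ↦ the hypothesis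
`2|(c₋ − y)_κ| ≤ 3(R₁r)M₁`; «Ω₁^{(1)} ∋ p′» ↦ the plaquettes `⟨y + z; κ, μ⟩`, `PlaqIn lo hi (z, κ, μ)`; `|V(∂p′) − 1|` ↦ `‖holT V (y+z) (plaqWord κ μ) − 1‖`
(§6: `dist1 (GaugeField.plaqHol V p′)`); `g₀p(g₀)`, `R₁r(g₀)`, `M₁`, `L` ↦ real parameters.

HONEST SCOPE. (i) Values: units `𝔸ˣ` of a Banach algebra with the norm-one / unitary hypotheses of the cell file (every closed `G ≤ U(𝔸)` at
once); §6 specialises to the cell's `U(N)`, §8 (v1.1) to the cell's `SU(N)` through the inclusion `SU(N) ≤ U(N)`.  (ii) As in the cell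
file, the REPRESENTATIVE of (29) — print's [7] Sect. F gauge with `𝓗(B) = HB + A₁` ((158) of [7]) — is NOT constructed (block B11); what is
proved is the axial representative `V^{v₀} = exp iB` of (27) itself.  (iii) The comb `Γ_{y,x}` on the torus is read through the least-absolute-
value representative of `x − y`; it is THE contour of [4] p. 24 as long as `□₁` does not wrap around the torus (side `3RM₁` below half the
period `2L^{m+K−j}` — print's standing regime, implicit on p. 263); the return path `Γ_{c₊,y}` is the comb of `(c₋ − y) + e_μ`, equal to that of
`c₊ − y` under the explicit no-wrap hypothesis of `holT_contourT` / `rel_shift_of_le`.  (iv) (28) is proved with the hypothesis (13) on the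
plaquettes of an integer box around `y` containing the bond (print: on `Ω₁^{(1)}`, which contains a neighbourhood of `□₁`); the constant of the
first member is b07's (`2·2L²`), the second member is print's `8` (in fact `6` suffices, as in the cell file).  (v) `P.d` is free except in the
printed form of (28) (`d = 3`).  (vi) Nothing of [Balaban1985UV3] beyond the two displays and their three sentences is asserted; the cell file
`…B10Eq27AxialLog` and b07's `B7Prop1Explicit` / `B7Prop1Local` are used BY NAME, byte-identical.

WHAT THIS FILE PROVES (kernel, no `sorry`, no named facts; definitions with bodies `transl`, `pull`, `gaugeActT`, `holT`, `rel`, `contourT`,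
`axialT`, `B27T`, `unitsField` (+ v1.1: `suIncl`, `toUField`), theorems otherwise; axioms standard).  Value = SKELETON rows B10.Eq27 / B10.Eq28 typed WITH BODY and proved
ON PRINT'S CARRIER (the torus), identified with the cell's (13)/(4) letters at the consumption site; NOT a construction of the [7]-§F gauge,
NOT summit progress.
-/

noncomputable section

open NormedSpace

namespace Literature.MathematicalPhysics.QuantumFieldTheory.Balaban1983to89.B10Eq27TorusAxialLog

open B7Prop1Explicit renaming Site → LSite
open B7Prop1Explicit (Letter e hol stepHol treeWord axialFn revWord disp plaqWord l1 U1 hol_cons hol_nil stepHol_true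
  stepHol_false hol_append disp_treeWord)
open B7Prop2Explicit (unitaryUnits mem_unitaryUnits unitaryUnits_le_U1 star_mlog_eq_neg hol_mem_of)
open B7Prop1Local (InBox AgreeOn PlaqIn)
open MatrixLog (mlog exp_mlog mlog_one norm_mlog_le_two_mul)
open B10Eq27AxialLog (contour27 B27 hol_contour27)

/-! ## §1 The torus dictionary: integer translates, the periodic pullback based at `y`, torus word holonomy -/

section Dictionary

variable {P : Params} {j : ℕ}

/-- The translate `y + z` of a torus site `y ∈ T^{(j)}` by an integer vector `z ∈ ℤ^d` (coordinates mod the period).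
(bookkeeping of the torus sites of [Balaban1987RG1] (0.1), no content of the series) [cite: Balaban1987RG1, (0.1) p.251] -/
def transl (y : Site P j) (z : LSite P.d) : Site P j := fun ν => y ν + ((z ν : ℤ) : ZMod (P.sitesPerDir j))

/-- Coordinates of the translate. (bookkeeping of the torus sites of [Balaban1987RG1] (0.1), no content of the series) [cite: Balaban1987RG1, (0.1) p.251] -/
theorem transl_apply (y : Site P j) (z : LSite P.d) (ν : Fin P.d) :
    transl y z ν = y ν + ((z ν : ℤ) : ZMod (P.sitesPerDir j)) := rfl

/-- `y + 0 = y`. (bookkeeping of the torus sites of [Balaban1987RG1] (0.1), no content of the series) [cite: Balaban1987RG1, (0.1) p.251] -/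
@[simp] theorem transl_zero (y : Site P j) : transl y 0 = y := by
  funext ν; simp [transl_apply]

/-- `y + (z + z′) = (y + z) + z′`. (bookkeeping of the torus sites of [Balaban1987RG1] (0.1), no content of the series) [cite: Balaban1987RG1, (0.1) p.251] -/
theorem transl_add (y : Site P j) (z z' : LSite P.d) : transl y (z + z') = transl (transl y z) z' := by
  funext ν; simp [transl_apply, add_assoc]

/-- `y + (z + e_μ) = (y + z) + e_μ` (the torus step `Site.shift`). (bookkeeping of the torus sites of [Balaban1987RG1] (0.1), no content of the
series) [cite: Balaban1987RG1, (0.1) p.251] -/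
theorem transl_add_e (y : Site P j) (z : LSite P.d) (μ : Fin P.d) : transl y (z + e μ) = (transl y z).shift μ := by
  funext ν
  rw [transl_apply, Site.shift_apply, transl_apply, transl_apply, Pi.add_apply, B7Prop1Explicit.e_apply]
  by_cases h : ν = μ
  · subst h; simp [add_assoc]
  · simp [h]

/-- `y + (z − e_μ) = (y + z) − e_μ` (the torus step `Site.unshift`). (bookkeeping of the torus sites of [Balaban1987RG1] (0.1), no content of the
series) [cite: Balaban1987RG1, (0.1) p.251] -/
theorem transl_sub_e (y : Site P j) (z : LSite P.d) (μ : Fin P.d) : transl y (z - e μ) = (transl y z).unshift μ := by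
  funext ν
  rw [transl_apply, Site.unshift_apply, transl_apply, transl_apply, Pi.sub_apply, B7Prop1Explicit.e_apply]
  by_cases h : ν = μ
  · subst h; simp [add_sub_assoc]
  · simp [h]

variable {G : Type*}

/-- **The periodic pullback of a torus configuration to `ℤ^d`, based at `y`**: `V♯_y(z, z + e_μ) := V(y + z, y + z + e_μ)`
— a periodic configuration on the universal cover; every `ℤ^d` statement of the cell file `B10Eq27AxialLog` about `V♯_y`
read from `0` is a statement about `V` read from `y`. (bookkeeping of the parallel transport (9), no content of the series) [cite: Balaban1985Averaging, (9) p.18] -/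
def pull (V : GaugeField P j G) (y : Site P j) : LSite P.d → Fin P.d → G := fun z μ => V ⟨transl y z, μ⟩

/-- The pullback's bond variables. (bookkeeping of the parallel transport (9), no content of the series) [cite: Balaban1985Averaging, (9) p.18] -/
theorem pull_apply (V : GaugeField P j G) (y : Site P j) (z : LSite P.d) (μ : Fin P.d) :
    pull V y z μ = V ⟨transl y z, μ⟩ := rfl

variable [Group G]

/-- The gauge action `V^u(x, x′) = u(x) V(x, x′) u(x′)⁻¹` of [Balaban1985Averaging] (8) on torus configurations with values in ANY group
(`Setup`'s `GaugeField.gaugeAct` asks for a `GaugeGroup`; the two agree, `gaugeActT_eq_gaugeAct`). [cite: Balaban1985Averaging, (8) p.19] -/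
def gaugeActT (u : GaugeTransf P j G) (V : GaugeField P j G) : GaugeField P j G := fun b => u b.src * V b * (u b.tgt)⁻¹

/-- The bond variables of `V^u`. [cite: Balaban1985Averaging, (8) p.19] -/
theorem gaugeActT_apply (u : GaugeTransf P j G) (V : GaugeField P j G) (b : PBond P j) :
    gaugeActT u V b = u b.src * V b * (u b.tgt)⁻¹ := rfl

/-- **Parallel transport on the torus `T^{(j)}` along the lattice word `w` spelled from `x`** ([Balaban1985Averaging] (9):
`V(Γ) = V(b₁) ⋯ V(b_n)`, `V(−b) = V(b)⁻¹`), for configurations with values in any group. [cite: Balaban1985Averaging, (9) p.18] -/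
def holT (V : GaugeField P j G) : Site P j → List (Letter P.d) → G
  | _, [] => 1
  | x, (μ, true) :: w => V ⟨x, μ⟩ * holT V (x.shift μ) w
  | x, (μ, false) :: w => (V ⟨x.unshift μ, μ⟩)⁻¹ * holT V (x.unshift μ) w

/-- `V(∅) = 1`. (bookkeeping of the parallel transport (9), no content of the series) [cite: Balaban1985Averaging, (9) p.18] -/
@[simp] theorem holT_nil (V : GaugeField P j G) (x : Site P j) : holT V x [] = 1 := rfl

/-- The forward letter `+e_μ` from `x` contributes `V(x, x + e_μ)`. (bookkeeping of the parallel transport (9), no content of the series) [cite: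
Balaban1985Averaging, (9) p.18] -/
@[simp] theorem holT_cons_true (V : GaugeField P j G) (x : Site P j) (μ : Fin P.d) (w : List (Letter P.d)) :
    holT V x ((μ, true) :: w) = V ⟨x, μ⟩ * holT V (x.shift μ) w := rfl

/-- The backward letter `−e_μ` from `x` contributes `V(x − e_μ, x)⁻¹`. (bookkeeping of the parallel transport (9), no content of the series) [cite:
Balaban1985Averaging, (9) p.18] -/
@[simp] theorem holT_cons_false (V : GaugeField P j G) (x : Site P j) (μ : Fin P.d) (w : List (Letter P.d)) :
    holT V x ((μ, false) :: w) = (V ⟨x.unshift μ, μ⟩)⁻¹ * holT V (x.unshift μ) w := rfl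

/-- **THE DICTIONARY**: parallel transport of the pullback `V♯_y` along `w` from `z ∈ ℤ^d` (the cell file's `hol`) IS parallel
transport of `V` along `w` from `y + z ∈ T^{(j)}`. (bookkeeping of the parallel transport (9), no content of the series) [cite: Balaban1985Averaging, (9) p.18] -/
theorem hol_pull (V : GaugeField P j G) (y : Site P j) : ∀ (z : LSite P.d) (w : List (Letter P.d)),
    hol (pull V y) z w = holT V (transl y z) w
  | z, [] => by rw [hol_nil, holT_nil]
  | z, (μ, true) :: w => by
    rw [hol_cons, stepHol_true, B7Prop1Explicit.Letter.vec_true, hol_pull V y (z + e μ) w, transl_add_e,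
      holT_cons_true, pull_apply]
  | z, (μ, false) :: w => by
    rw [hol_cons, stepHol_false, B7Prop1Explicit.Letter.vec_false, ← sub_eq_add_neg, hol_pull V y (z - e μ) w,
      transl_sub_e, holT_cons_false, pull_apply, transl_sub_e]

/-- Torus transport read from `y` itself (`z = 0`). (bookkeeping of the parallel transport (9), no content of the series) [cite: Balaban1985Averaging, (9) p.18] -/
theorem hol_pull_zero (V : GaugeField P j G) (y : Site P j) (w : List (Letter P.d)) :
    hol (pull V y) 0 w = holT V y w := by
  rw [hol_pull, transl_zero]

/-- `V(Γ₁ ∪ Γ₂) = V(Γ₁) V(Γ₂)` on the torus, the second transport read from the end `x + disp Γ₁` of the first walk.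
[cite: Balaban1985Averaging, (9) p.18] -/
theorem holT_append (V : GaugeField P j G) (x : Site P j) (w₁ w₂ : List (Letter P.d)) :
    holT V x (w₁ ++ w₂) = holT V x w₁ * holT V (transl x (disp w₁)) w₂ := by
  rw [← hol_pull_zero, hol_append, hol_pull_zero, hol_pull, zero_add]

/-- The plaquette word `(+e_κ, +e_μ, −e_κ, −e_μ)` from `x` transports to the plaquette variable
`V(x,x+e_κ) V(x+e_κ,x+e_κ+e_μ) V(x+e_μ,x+e_κ+e_μ)⁻¹ V(x,x+e_μ)⁻¹` of [Balaban1985Averaging] (9). [cite: Balaban1985Averaging, (9) p.19] -/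
theorem holT_plaqWord (V : GaugeField P j G) (x : Site P j) (κ μ : Fin P.d) :
    holT V x (plaqWord κ μ) = V ⟨x, κ⟩ * V ⟨x.shift κ, μ⟩ * (V ⟨x.shift μ, κ⟩)⁻¹ * (V ⟨x, μ⟩)⁻¹ := by
  simp only [plaqWord, holT_cons_true, holT_cons_false, holT_nil, mul_one, mul_assoc]
  rw [Site.shift_comm x κ μ, Site.unshift_shift, Site.unshift_shift]

end Dictionary

/-! ### Bridge to the pub-balaban cell's torus walks (`T4Continuum.walk` / `holAt`) and plaquette variables (`plaqHol`) -/

section Bridge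

variable {P : Params} {j : ℕ} {G : Type*} [GaugeGroup G]

/-- For a `GaugeGroup`-valued configuration, `holT V x w` IS the cell's holonomy `holAt V (walk x w)` of the lattice walk spelled
by `w` from `x` (`T4Continuum`). (bookkeeping of (9), no content of the series) [cite: Balaban1985Averaging, (9) p.19] -/
theorem holT_eq_holAt (V : GaugeField P j G) : ∀ (x : Site P j) (w : List (Letter P.d)),
    holT V x w = T4Continuum.holAt V (T4Continuum.walk x w)
  | x, [] => by rw [holT_nil, T4Continuum.walk, T4Continuum.holAt_nil]
  | x, (μ, true) :: w => by
    rw [holT_cons_true, T4Continuum.walk, T4Continuum.holAt_cons, holT_eq_holAt V (x.shift μ) w]; rfl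
  | x, (μ, false) :: w => by
    rw [holT_cons_false, T4Continuum.walk, T4Continuum.holAt_cons, holT_eq_holAt V (x.unshift μ) w]; rfl

/-- For a `GaugeGroup`-valued configuration the gauge action `gaugeActT` IS `Setup`'s `GaugeField.gaugeAct`. (bookkeeping of the gauge action (8), no
content of the series) [cite: Balaban1985Averaging, (8) p.19] -/
theorem gaugeActT_eq_gaugeAct (u : GaugeTransf P j G) (V : GaugeField P j G) : gaugeActT u V = GaugeField.gaugeAct u V := rfl

/-- The plaquette word transports to the cell's plaquette variable `GaugeField.plaqHol V p` of `Setup` ([Balaban1985Averaging] (9),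
`p = ⟨x; κ < μ⟩`). [cite: Balaban1985Averaging, (9) p.19] -/
theorem holT_plaqWord_eq_plaqHol (V : GaugeField P j G) (p : Plaq P j) :
    holT V p.src (plaqWord p.μ p.ν) = GaugeField.plaqHol V p := by
  rw [holT_plaqWord]; rfl

/-- The pullback's `ℤ^d` plaquette holonomies are the torus plaquette variables: `V♯_y(∂(z; κ, μ)) = V(∂p)`,
`p = ⟨y + z; κ < μ⟩`. (bookkeeping of (9), no content of the series) [cite: Balaban1985Averaging, (9) p.19] -/
theorem hol_pull_plaqWord (V : GaugeField P j G) (y : Site P j) (z : LSite P.d) {κ μ : Fin P.d} (h : κ < μ) :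
    hol (pull V y) z (plaqWord κ μ) = GaugeField.plaqHol V ⟨transl y z, κ, μ, h⟩ := by
  rw [hol_pull]; exact holT_plaqWord_eq_plaqHol V ⟨transl y z, κ, μ, h⟩

end Bridge

/-! ## §2 Relative coordinates on the torus: the symmetric representative of `x − y` -/

section Rel

variable {P : Params} {j : ℕ}

/-- The relative position `x − y ∈ ℤ^d` of two torus sites, each coordinate read as the representative of least absolute value
(`ZMod.valMinAbs`; canonical — the unique representative — as long as `2|x_ν − y_ν| <` the period, in particular throughout
print's cube `□₁` of side `3RM₁`). (bookkeeping for the contour of (27) on the torus, no content of the series) [cite: Balaban1985UV3, (27) p.263] -/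
def rel (y x : Site P j) : LSite P.d := fun ν => (x ν - y ν).valMinAbs

/-- Coordinates of the relative position. (bookkeeping for the contour of (27) on the torus, no content of the series) [cite: Balaban1985UV3, (27) p.263] -/
theorem rel_apply (y x : Site P j) (ν : Fin P.d) : rel y x ν = (x ν - y ν).valMinAbs := rfl

/-- `y + (x − y) = x`. (bookkeeping for the contour of (27) on the torus, no content of the series) [cite: Balaban1985UV3, (27) p.263] -/
@[simp] theorem transl_rel (y x : Site P j) : transl y (rel y x) = x := by
  funext ν; simp [transl_apply, rel_apply, ZMod.coe_valMinAbs]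

/-- `y − y = 0`. (bookkeeping for the contour of (27) on the torus, no content of the series) [cite: Balaban1985UV3, (27) p.263] -/
@[simp] theorem rel_self (y : Site P j) : rel y y = 0 := by
  funext ν; simp [rel_apply]

/-- Each relative coordinate is at most half the period in absolute value. (bookkeeping for the contour of (27) on the torus, no content of the
series) [cite: Balaban1985UV3, (27) p.263] -/
theorem natAbs_rel_le (y x : Site P j) (ν : Fin P.d) : (rel y x ν).natAbs ≤ P.sitesPerDir j / 2 :=
  ZMod.natAbs_valMinAbs_le _

/-- The relative coordinates ARE the least-absolute-value representatives: `2(x − y)_ν ∈ (−n, n]`, `n` the period. (bookkeeping for the contour of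
(27) on the torus, no content of the series) [cite: Balaban1985UV3, (27) p.263] -/
theorem rel_mem_Ioc (y x : Site P j) (ν : Fin P.d) :
    rel y x ν * 2 ∈ Set.Ioc (-(P.sitesPerDir j : ℤ)) (P.sitesPerDir j) :=
  ((ZMod.valMinAbs_spec (x ν - y ν) (rel y x ν)).1 rfl).2

/-- An integer vector in the symmetric window is the relative position of its translate: `(y + z) − y = z`. (bookkeeping for the contour of (27) on
the torus, no content of the series) [cite: Balaban1985UV3, (27) p.263] -/
theorem rel_transl_of_mem (y : Site P j) (z : LSite P.d)
    (hz : ∀ ν, z ν * 2 ∈ Set.Ioc (-(P.sitesPerDir j : ℤ)) (P.sitesPerDir j)) : rel y (transl y z) = z := by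
  funext ν
  rw [rel_apply, transl_apply, add_sub_cancel_left]
  exact (ZMod.valMinAbs_spec _ _).2 ⟨rfl, hz ν⟩

/-- **No wrap-around**: if `2((x − y)_μ + 1) ≤ n` then the relative position of `x + e_μ` is `(x − y) + e_μ` — the comb contour to
`c₊` is the comb contour to `c₋` displaced by one step (always the case inside `□₁`, whose side `3RM₁` is far below half the period).
(bookkeeping for the contour of (27) on the torus, no content of the series) [cite: Balaban1985UV3, (27) p.263] -/
theorem rel_shift_of_le (y x : Site P j) (μ : Fin P.d) (h : (rel y x μ + 1) * 2 ≤ (P.sitesPerDir j : ℤ)) :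
    rel y (x.shift μ) = rel y x + e μ := by
  have hx : x.shift μ = transl y (rel y x + e μ) := by rw [transl_add_e, transl_rel]
  rw [hx]
  refine rel_transl_of_mem y _ fun ν => ?_
  rw [Pi.add_apply, B7Prop1Explicit.e_apply]
  by_cases hν : ν = μ
  · subst hν
    rw [if_pos rfl]
    have h1 := rel_mem_Ioc y x ν
    exact ⟨by have := h1.1; linarith, h⟩
  · rw [if_neg hν, add_zero]; exact rel_mem_Ioc y x ν

/-- **Print's regime has no wrap-around**: if `x` lies in the cube of side `S` centred at `y` (`2|(x − y)_κ| ≤ S`, print: `S = 3RM₁`) and the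
cube fits in the torus with a margin (`S + 2 ≤` period), then the no-wrap condition of `rel_shift_of_le` / `holT_contourT` holds at every axis.
(bookkeeping for the contour of (27) on the torus, no content of the series) [cite: Balaban1985UV3, (27) p.263] -/
theorem noWrap_of_cube (y x : Site P j) (μ : Fin P.d) {S : ℝ} (hx : ∀ κ, 2 * (((rel y x) κ).natAbs : ℝ) ≤ S)
    (hS : S + 2 ≤ (P.sitesPerDir j : ℝ)) : (rel y x μ + 1) * 2 ≤ (P.sitesPerDir j : ℤ) := by
  have h0 : (rel y x μ : ℤ) ≤ ((rel y x μ).natAbs : ℤ) := Int.le_natAbs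
  have h1 : ((rel y x μ : ℤ) : ℝ) ≤ ((rel y x μ).natAbs : ℝ) := by
    have h := (Int.cast_le (R := ℝ)).2 h0
    rwa [Int.cast_natCast] at h
  have h2 := hx μ
  have h3 : (((rel y x μ + 1) * 2 : ℤ) : ℝ) ≤ (P.sitesPerDir j : ℝ) := by push_cast; linarith
  exact_mod_cast h3

end Rel

/-! ## §3 Display (27) ON THE TORUS: `B(c) = (1/i) log V(Γ_{y,c₋} ∪ c ∪ Γ_{c₊,y})` for bonds `c` of `T^{(j)}` near `y` -/

section Def27

variable {P : Params} {j : ℕ}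

/-- **The contour `Γ_{y,c₋} ∪ c ∪ Γ_{c₊,y}` of (27) as a lattice word from `y`**: the comb contour `Γ_{y,c₋}` of (9)/(12)
([Balaban1985Averaging] p. 24: `Γ_{y,x} = [y, (y₁, …, y_{d−1}, x_d)] ∪ … ∪ [(y₁, x₂, …, x_d), x]`, the coordinates changed in the
order `d, …, 1` — the cell's `treeWord` of the relative position `c₋ − y`), then the bond `c`, then the reversed comb to `c₊ = c₋ + e_μ`
(= the cell file's `contour27` on `ℤ^d` read at the relative positions). [cite: Balaban1985UV3, (27) p.263; Balaban1985Averaging, p.24] -/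
def contourT (y : Site P j) (c : PBond P j) : List (Letter P.d) := contour27 0 (rel y c.src) c.dir

/-- The word of (27) spelled out: `Γ_{y,c₋} ++ [c] ++ (Γ_{y,c₋+e_μ})⁻¹`. [cite: Balaban1985UV3, (27) p.263] -/
theorem contourT_eq (y : Site P j) (c : PBond P j) :
    contourT y c = treeWord (rel y c.src) ++ [(c.dir, true)] ++ revWord (treeWord (rel y c.src + e c.dir)) := by
  simp [contourT, contour27]

/-- The comb `Γ_{y,c₋}` ENDS AT `c₋`: after it the word of (27) traverses exactly the bond `c`. (bookkeeping for the contour of (27) on the torus, no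
content of the series) [cite: Balaban1985UV3, (27) p.263] -/
theorem transl_disp_treeWord_rel (y x : Site P j) : transl y (disp (treeWord (rel y x))) = x := by
  rw [disp_treeWord, transl_rel]

variable {G : Type*} [Group G]

/-- **The torus axial gauge transformation based at `y`**: `v₀(x) = V(Γ_{y,x})` ([Balaban1985Averaging] p. 24; the gauge of B10's
(9)/(12) p. 258), the comb read through the relative position `x − y`. [cite: Balaban1985Averaging, p.24; Balaban1985UV3, (9) p.258] -/
def axialT (V : GaugeField P j G) (y x : Site P j) : G := holT V y (treeWord (rel y x))

/-- `v₀(y) = 1`. (bookkeeping of the axial gauge of [Balaban1985Averaging] p. 24 on the torus) [cite: Balaban1985Averaging, p.24] -/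
@[simp] theorem axialT_self (V : GaugeField P j G) (y : Site P j) : axialT V y y = 1 := by
  simp [axialT]

/-- The cell file's `ℤ^d` axial gauge transformation of the pullback, based at `0`, is the torus one based at `y`:
`axialFn V♯_y 0 z = v₀(y + z)` whenever `z` is the relative position of `y + z` (symmetric window). (bookkeeping of the axial gauge of
[Balaban1985Averaging] p. 24 on the torus) [cite: Balaban1985Averaging, p.24] -/
theorem axialFn_pull_rel (V : GaugeField P j G) (y x : Site P j) : axialFn (pull V y) 0 (rel y x) = axialT V y x := by
  rw [axialFn, sub_zero, hol_pull_zero, axialT]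

/-- **(M1) on the torus: (27)'s holonomy is the axial-gauge bond variable.**  `V(Γ_{y,c₋} ∪ c ∪ Γ_{c₊,y}) = v₀(c₋) V(c) v₀′⁻¹`
with `v₀′ = V(Γ)` along the comb of the displaced relative position `(c₋ − y) + e_μ` — equal to `v₀(c₊)` as soon as the bond does not
wrap around the torus (`holT_contourT`). [cite: Balaban1985UV3, (27) p.263] -/
theorem holT_contourT' (V : GaugeField P j G) (y : Site P j) (c : PBond P j) :
    holT V y (contourT y c) = axialT V y c.src * V c * (holT V y (treeWord (rel y c.src + e c.dir)))⁻¹ := by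
  rw [contourT, ← hol_pull_zero, hol_contour27, B7Prop1Explicit.gaugeAct, axialFn_pull_rel, pull_apply, transl_rel, axialFn,
    sub_zero, hol_pull_zero]

/-- **(M1) on the torus, no wrap-around at `c`** (`2((c₋ − y)_μ + 1) ≤` period — automatic in `□₁`): `V(Γ_{y,c₋} ∪ c ∪ Γ_{c₊,y}) =
v₀(c₋) V(c) v₀(c₊)⁻¹ = V^{v₀}(c)`, the bond variable of `V` in the axial gauge based at `y` ([Balaban1985Averaging] p. 24 «V₀ = V^{v₀}
satisfies the conditions V₀(Γ_{y,x}) = 1»). [cite: Balaban1985UV3, (27) p.263; Balaban1985Averaging, (8) p.19] -/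
theorem holT_contourT (V : GaugeField P j G) (y : Site P j) (c : PBond P j)
    (hc : (rel y c.src c.dir + 1) * 2 ≤ (P.sitesPerDir j : ℤ)) :
    holT V y (contourT y c) = axialT V y c.src * V c * (axialT V y c.tgt)⁻¹ := by
  rw [holT_contourT', PBond.tgt]
  unfold axialT
  rw [rel_shift_of_le y c.src c.dir hc]

/-- The same in the letters of (8): `V(Γ_{y,c₋} ∪ c ∪ Γ_{c₊,y}) = (V^{v₀})(c)` (gauge action `gaugeActT`; = `Setup`'s `GaugeField.gaugeAct`
for `GaugeGroup`-valued `V`, `gaugeActT_eq_gaugeAct`). [cite: Balaban1985Averaging, (8) p.19] -/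
theorem holT_contourT_eq_gaugeActT (V : GaugeField P j G) (y : Site P j) (c : PBond P j)
    (hc : (rel y c.src c.dir + 1) * 2 ≤ (P.sitesPerDir j : ℤ)) :
    holT V y (contourT y c) = gaugeActT (axialT V y) V c := by
  rw [holT_contourT V y c hc, gaugeActT_apply]

variable {𝔸 : Type*} [NormedRing 𝔸] [NormedAlgebra ℂ 𝔸]

/-- **(27) ON THE TORUS** `T^{(j)}` (print: `T^{(1)}`, the lattice of `V = Ū` after the first step; bonds `c` of `□₁^{(1)} = □₁ ∩ T^{(1)}`,
`□₁` the cube of side `3RM₁` centred at `y`): `B(c) = (1/i) log V(Γ_{y,c₋} ∪ c ∪ Γ_{c₊,y})`, `log` the principal series `MatrixLog.mlog`,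
for configurations with values in the units of a Banach algebra `𝔸` (every closed `G ≤ U(𝔸)` at once): VERBATIM, the torus transport
`holT` of `V` from `y` along the word `contourT y c`, then `(1/i) log = (−i) • mlog`.  It IS the cell file's `ℤ^d` object `B27` of the periodic
pullback `V♯_y` at the relative position of `c₋` (`B27T_eq_B27_pull`), whence the transfer of every `ℤ^d` theorem.
[cite: Balaban1985UV3, (27) p.263] -/
def B27T (V : GaugeField P j 𝔸ˣ) (y : Site P j) (c : PBond P j) : 𝔸 :=
  (-Complex.I) • mlog ((holT V y (contourT y c) : 𝔸ˣ) : 𝔸)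

/-- (27) unfolded. [cite: Balaban1985UV3, (27) p.263] -/
theorem B27T_eq (V : GaugeField P j 𝔸ˣ) (y : Site P j) (c : PBond P j) :
    B27T V y c = (-Complex.I) • mlog ((holT V y (contourT y c) : 𝔸ˣ) : 𝔸) := rfl

/-- **THE TRANSFER**: (27) on the torus IS the cell file's `ℤ^d` configuration `B27` of the periodic pullback `V♯_y`, read from `0` at the
relative position `c₋ − y`. [cite: Balaban1985UV3, (27) p.263] -/
theorem B27T_eq_B27_pull (V : GaugeField P j 𝔸ˣ) (y : Site P j) (c : PBond P j) :
    B27T V y c = B27 (pull V y) 0 (rel y c.src) c.dir := by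
  rw [B27T, B27, ← hol_pull_zero]; rfl

/-- (27) = `(1/i) log` of the axial-gauge bond variable `v₀(c₋) V(c) v₀(c₊)⁻¹` (no wrap-around at `c`). [cite: Balaban1985UV3, (27) p.263] -/
theorem B27T_eq_axial (V : GaugeField P j 𝔸ˣ) (y : Site P j) (c : PBond P j)
    (hc : (rel y c.src c.dir + 1) * 2 ≤ (P.sitesPerDir j : ℤ)) :
    B27T V y c = (-Complex.I) • mlog ((axialT V y c.src * V c * (axialT V y c.tgt)⁻¹ : 𝔸ˣ) : 𝔸) := by
  rw [B27T_eq, holT_contourT V y c hc]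

/-- `iB(c) = log V(Γ_{y,c₋} ∪ c ∪ Γ_{c₊,y})`. (elementary, for (27)) [cite: Balaban1985UV3, (27) p.263] -/
theorem I_smul_B27T (V : GaugeField P j 𝔸ˣ) (y : Site P j) (c : PBond P j) :
    Complex.I • B27T V y c = mlog ((holT V y (contourT y c) : 𝔸ˣ) : 𝔸) := by
  rw [B27T_eq, smul_smul, mul_neg, Complex.I_mul_I, neg_neg, one_smul]

/-- `‖B(c)‖ = ‖log V(Γ_{y,c₋} ∪ c ∪ Γ_{c₊,y})‖`. (elementary, for (27)) [cite: Balaban1985UV3, (27) p.263] -/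
theorem norm_B27T (V : GaugeField P j 𝔸ˣ) (y : Site P j) (c : PBond P j) :
    ‖B27T V y c‖ = ‖mlog ((holT V y (contourT y c) : 𝔸ˣ) : 𝔸)‖ := by
  rw [B27T_eq, norm_smul, norm_neg, Complex.norm_I, one_mul]

variable [CompleteSpace 𝔸]

/-- `exp(iB(c)) = V(Γ_{y,c₋} ∪ c ∪ Γ_{c₊,y})` inside the disc of the logarithm: the axial gauge REPRESENTS `V` as `exp iB` near `y`
(p. 263 «represented as exp i𝓗(B)», here for the axial representative — HONEST SCOPE (ii)). [cite: Balaban1985UV3, (27) p.263] -/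
theorem exp_I_smul_B27T (V : GaugeField P j 𝔸ˣ) (y : Site P j) (c : PBond P j)
    (h : ‖((holT V y (contourT y c) : 𝔸ˣ) : 𝔸) - 1‖ < 1) :
    exp (Complex.I • B27T V y c) = ((holT V y (contourT y c) : 𝔸ˣ) : 𝔸) := by
  rw [I_smul_B27T, exp_mlog h]

end Def27

/-! ### Gauge covariance of (27) on the torus -/

section Covariance

variable {P : Params} {j : ℕ} {G : Type*} [Group G]

/-- The pullback of a gauge-transformed torus configuration is the `ℤ^d` gauge transform of the pullback by the pulled-back gauge
transformation ([Balaban1985Averaging] (8) on both carriers). [cite: Balaban1985Averaging, (8) p.19] -/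
theorem pull_gaugeActT (u : GaugeTransf P j G) (V : GaugeField P j G) (y : Site P j) :
    pull (gaugeActT u V) y = B7Prop1Explicit.gaugeAct (fun z => u (transl y z)) (pull V y) := by
  funext z μ
  rw [pull_apply, B7Prop1Explicit.gaugeAct, pull_apply, transl_add_e, gaugeActT_apply]; rfl

/-- Residual covariance of the closed contour of (27): under `V ↦ V^u` its holonomy from `y` is conjugated by `u(y)` — the mechanism of
p. 264 «(26) implies the invariance with respect to the global transformations R(U)». [cite: Balaban1985UV3, (31) p.264] -/
theorem holT_contourT_gaugeActT (u : GaugeTransf P j G) (V : GaugeField P j G) (y : Site P j) (c : PBond P j) :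
    holT (gaugeActT u V) y (contourT y c) = u y * holT V y (contourT y c) * (u y)⁻¹ := by
  rw [← hol_pull_zero, pull_gaugeActT, contourT, B10Eq27AxialLog.hol_contour27_gaugeAct, hol_pull_zero, transl_zero]

variable {𝔸 : Type*} [NormedRing 𝔸] [NormOneClass 𝔸] [NormedAlgebra ℂ 𝔸] [CompleteSpace 𝔸]

/-- **Residual covariance of (27) on the torus**: `B_{V^u}(c) = u(y) B_V(c) u(y)⁻¹` when `u(y)` is a norm-one unit and the contour
holonomy lies in the disc of the logarithm (for constant `u ≡ W`: `B ↦ W B W⁻¹`, p. 264 before (31)). [cite: Balaban1985UV3, (31) p.264] -/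
theorem B27T_gaugeAct {u : GaugeTransf P j 𝔸ˣ} (V : GaugeField P j 𝔸ˣ) (y : Site P j) (c : PBond P j) (hu : u y ∈ U1 𝔸)
    (h : ‖((holT V y (contourT y c) : 𝔸ˣ) : 𝔸) - 1‖ < 1) :
    B27T (gaugeActT u V) y c = (u y : 𝔸) * B27T V y c * ((u y)⁻¹ : 𝔸ˣ) := by
  have h' : ‖((hol (pull V y) 0 (contour27 0 (rel y c.src) c.dir) : 𝔸ˣ) : 𝔸) - 1‖ < 1 := by
    rw [hol_pull_zero]; exact h
  have := B10Eq27AxialLog.B27_gaugeAct (u := fun z => u (transl y z)) (pull V y) 0 (rel y c.src) c.dir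
    (by rw [transl_zero]; exact hu) h'
  rw [B27T_eq_B27_pull, B27T_eq_B27_pull, pull_gaugeActT, this, transl_zero]

end Covariance

/-! ## §4 Display (28) ON THE TORUS from the plaquette restrictions (13) near `□₁`

Print has (13) `|V(∂p′) − 1| < 2L²g₀p(g₀)` for the plaquettes `p′` of `Ω₁^{(1)}`, a neighbourhood of `□₁`.  The hypotheses below
ask it for the torus plaquettes `⟨y + z; κ, μ⟩` with `z` in an integer box `[lo, hi] ∋ 0` (the relative positions covering `□₁` and one
more layer); by the dictionary `hol_pull` they are the cell file's LOCAL hypotheses for the pullback `V♯_y`, and its `…_local` theorems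
((28) through b07's clamped non-abelian Stokes ladder) transfer verbatim. -/

section Bound28

variable {P : Params} {j : ℕ} {𝔸 : Type*} [NormedRing 𝔸] [NormOneClass 𝔸] {lo hi : LSite P.d}

/-- `‖V(Γ_{y,c₋} ∪ c ∪ Γ_{c₊,y}) − 1‖ ≤ |c₋ − y|₁·α` on the torus, assuming `‖V(∂p) − 1‖ ≤ α` only for the plaquettes `⟨y + z; κ, μ⟩`,
`z` in a box containing `0`, `c₋ − y` and `c₋ − y + e_μ` ([Balaban1985Averaging] pp. 24–25 «|V₀,b − 1| < |b₋ − y|α₀», the cell file's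
`norm_hol_contour27_sub_one_le_local` for `V♯_y`). [cite: Balaban1985Averaging, pp.24–25] -/
theorem norm_holT_contourT_sub_one_le (hlohi : ∀ i, lo i ≤ hi i) (V : GaugeField P j 𝔸ˣ) (hV : ∀ b, V b ∈ U1 𝔸)
    (y : Site P j) {α : ℝ}
    (h13 : ∀ (z : LSite P.d) (κ μ : Fin P.d), κ ≠ μ → PlaqIn lo hi (z, κ, μ) →
      ‖((holT V (transl y z) (plaqWord κ μ) : 𝔸ˣ) : 𝔸) - 1‖ ≤ α)
    (hα : 0 ≤ α) (h0 : InBox lo hi 0) (c : PBond P j) (hc : InBox lo hi (rel y c.src))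
    (hce : InBox lo hi (rel y c.src + e c.dir)) :
    ‖((holT V y (contourT y c) : 𝔸ˣ) : 𝔸) - 1‖ ≤ l1 (rel y c.src) * α := by
  have h := B10Eq27AxialLog.norm_hol_contour27_sub_one_le_local hlohi (pull V y) (fun z κ => hV _) 0
    (fun z κ μ hne hp => by rw [hol_pull]; exact h13 z κ μ hne hp) hα h0 (rel y c.src) c.dir hc hce
  rwa [hol_pull_zero, sub_zero] at h

variable [NormedAlgebra ℂ 𝔸] [CompleteSpace 𝔸]

/-- **(28) on the torus, generic form**: `‖B(c)‖ ≤ 2|c₋ − y|₁·α` under the local plaquette hypothesis, as long as `|c₋ − y|₁·α ≤ ½`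
(`|log X| ≤ 2|X − 1|`; [Balaban1985Averaging] p. 25 «|A_b| < 2|b₋ − y|α₀»). [cite: Balaban1985UV3, (28) p.263] -/
theorem norm_B27T_le (hlohi : ∀ i, lo i ≤ hi i) (V : GaugeField P j 𝔸ˣ) (hV : ∀ b, V b ∈ U1 𝔸) (y : Site P j) {α : ℝ}
    (h13 : ∀ (z : LSite P.d) (κ μ : Fin P.d), κ ≠ μ → PlaqIn lo hi (z, κ, μ) →
      ‖((holT V (transl y z) (plaqWord κ μ) : 𝔸ˣ) : 𝔸) - 1‖ ≤ α)
    (hα : 0 ≤ α) (h0 : InBox lo hi 0) (c : PBond P j) (hc : InBox lo hi (rel y c.src))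
    (hce : InBox lo hi (rel y c.src + e c.dir)) (hsmall : (l1 (rel y c.src) : ℝ) * α ≤ 1 / 2) :
    ‖B27T V y c‖ ≤ 2 * (l1 (rel y c.src) * α) := by
  rw [norm_B27T]
  have h := norm_holT_contourT_sub_one_le hlohi V hV y h13 hα h0 c hc hce
  exact (norm_mlog_le_two_mul (h.trans hsmall)).trans (by linarith)

/-- `exp(iB(c)) = V(Γ_{y,c₋} ∪ c ∪ Γ_{c₊,y})` on every bond of the box with `|c₋ − y|₁·α < 1`. [cite: Balaban1985UV3, (27) p.263] -/
theorem exp_I_smul_B27T_of_plaq (hlohi : ∀ i, lo i ≤ hi i) (V : GaugeField P j 𝔸ˣ) (hV : ∀ b, V b ∈ U1 𝔸) (y : Site P j)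
    {α : ℝ} (h13 : ∀ (z : LSite P.d) (κ μ : Fin P.d), κ ≠ μ → PlaqIn lo hi (z, κ, μ) →
      ‖((holT V (transl y z) (plaqWord κ μ) : 𝔸ˣ) : 𝔸) - 1‖ ≤ α)
    (hα : 0 ≤ α) (h0 : InBox lo hi 0) (c : PBond P j) (hc : InBox lo hi (rel y c.src))
    (hce : InBox lo hi (rel y c.src + e c.dir)) (hlt : (l1 (rel y c.src) : ℝ) * α < 1) :
    exp (Complex.I • B27T V y c) = ((holT V y (contourT y c) : 𝔸ˣ) : 𝔸) :=
  exp_I_smul_B27T V y c ((norm_holT_contourT_sub_one_le hlohi V hV y h13 hα h0 c hc hce).trans_lt hlt)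

/-- **The gauge-transformed configuration is represented as `exp iB` on the torus**: `(V^{v₀})(c) = exp(iB(c))`, `v₀ = axialT V y` the
axial gauge based at `y`, on every non-wrapping bond of the box with `|c₋ − y|₁·α < 1` (p. 263 «the gauge transformed U₁ is represented
as exp i𝓗(B) in the neighbourhood of □₁» — for the AXIAL representative; print's [7]-§F representative is HONEST SCOPE (ii)).
[cite: Balaban1985UV3, (27)–(29) p.263] -/
theorem gaugeAct_axialT_eq_exp (hlohi : ∀ i, lo i ≤ hi i) (V : GaugeField P j 𝔸ˣ) (hV : ∀ b, V b ∈ U1 𝔸) (y : Site P j)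
    {α : ℝ} (h13 : ∀ (z : LSite P.d) (κ μ : Fin P.d), κ ≠ μ → PlaqIn lo hi (z, κ, μ) →
      ‖((holT V (transl y z) (plaqWord κ μ) : 𝔸ˣ) : 𝔸) - 1‖ ≤ α)
    (hα : 0 ≤ α) (h0 : InBox lo hi 0) (c : PBond P j) (hc : InBox lo hi (rel y c.src))
    (hce : InBox lo hi (rel y c.src + e c.dir)) (hlt : (l1 (rel y c.src) : ℝ) * α < 1)
    (hwrap : (rel y c.src c.dir + 1) * 2 ≤ (P.sitesPerDir j : ℤ)) :
    ((gaugeActT (axialT V y) V c : 𝔸ˣ) : 𝔸) = exp (Complex.I • B27T V y c) := by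
  rw [exp_I_smul_B27T_of_plaq hlohi V hV y h13 hα h0 c hc hce hlt, holT_contourT_eq_gaugeActT V y c hwrap]

/-- **(28), first member, on the torus**: under (13) `‖V(∂p′) − 1‖ ≤ 2L²g` (`g = «g₀p(g₀)»`) near `□₁`, `‖B(c)‖ ≤ 4L²|c₋ − y|₁g` on every bond
of the box with `|c₋ − y|₁·2L²g ≤ ½`. [cite: Balaban1985UV3, (28) p.263] -/
theorem eq28T_first (hlohi : ∀ i, lo i ≤ hi i) (V : GaugeField P j 𝔸ˣ) (hV : ∀ b, V b ∈ U1 𝔸) (y : Site P j) {L g : ℝ}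
    (hLg : 0 ≤ L ^ 2 * g)
    (h13 : ∀ (z : LSite P.d) (κ μ : Fin P.d), κ ≠ μ → PlaqIn lo hi (z, κ, μ) →
      ‖((holT V (transl y z) (plaqWord κ μ) : 𝔸ˣ) : 𝔸) - 1‖ ≤ 2 * L ^ 2 * g)
    (h0 : InBox lo hi 0) (c : PBond P j) (hc : InBox lo hi (rel y c.src)) (hce : InBox lo hi (rel y c.src + e c.dir))
    (hsmall : (l1 (rel y c.src) : ℝ) * (2 * L ^ 2 * g) ≤ 1 / 2) :
    ‖B27T V y c‖ ≤ 4 * L ^ 2 * l1 (rel y c.src) * g := by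
  have h := norm_B27T_le hlohi V hV y h13 (by linarith) h0 c hc hce hsmall
  linarith

/-- **(28) as printed, on the torus** (`d = 3`): `□₁` the cube of side `3RM₁`, `R = R₁r(g₀)`, centred at `y` — `2|(c₋ − y)_κ| ≤ 3RM₁` in the
relative coordinates —, (13) with `2L²g₀p(g₀)` for the plaquettes `⟨y + z; κ, μ⟩` of a box `[lo, hi] ∋ 0` containing `c₋ − y` and `c₋ − y + e_μ`,
and the smallness «for g₀ sufficiently small the number on the right-hand side is small» as `8L²·3R₁M₁r(g₀)·g₀p(g₀) ≤ 1`: then BOTH MEMBERS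
`‖B(c)‖ ≤ 4L²|c₋ − y|g₀p(g₀) ≤ 8L²3R₁M₁r(g₀)g₀p(g₀)` (`p`, `r` the numbers `p(g₀)`, `r(g₀)`). [cite: Balaban1985UV3, (28) p.263] -/
theorem eq28T_print (hd : P.d = 3) (hlohi : ∀ i, lo i ≤ hi i) (V : GaugeField P j 𝔸ˣ) (hV : ∀ b, V b ∈ U1 𝔸) (y : Site P j)
    {L g₀ p R₁ r M₁ : ℝ} (hgp : 0 ≤ g₀ * p)
    (h13 : ∀ (z : LSite P.d) (κ μ : Fin P.d), κ ≠ μ → PlaqIn lo hi (z, κ, μ) →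
      ‖((holT V (transl y z) (plaqWord κ μ) : 𝔸ˣ) : 𝔸) - 1‖ ≤ 2 * L ^ 2 * (g₀ * p))
    (h0 : InBox lo hi 0) (c : PBond P j) (hc : InBox lo hi (rel y c.src)) (hce : InBox lo hi (rel y c.src + e c.dir))
    (hbox : ∀ κ, 2 * (((rel y c.src) κ).natAbs : ℝ) ≤ 3 * (R₁ * r) * M₁)
    (hsmall : 8 * L ^ 2 * (3 * R₁ * M₁ * r) * (g₀ * p) ≤ 1) :
    ‖B27T V y c‖ ≤ 4 * L ^ 2 * l1 (rel y c.src) * (g₀ * p) ∧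
      4 * L ^ 2 * (l1 (rel y c.src) : ℝ) * (g₀ * p) ≤ 8 * L ^ 2 * (3 * R₁ * M₁ * r) * (g₀ * p) := by
  have hLg : 0 ≤ L ^ 2 * (g₀ * p) := mul_nonneg (sq_nonneg L) hgp
  have hl : 2 * (l1 (rel y c.src) : ℝ) ≤ (P.d : ℝ) * (3 * (R₁ * r) * M₁) :=
    B10Eq27AxialLog.two_mul_l1_le_real hbox
  have hd' : (P.d : ℝ) = 3 := by exact_mod_cast hd
  rw [hd'] at hl
  have hR : (0 : ℝ) ≤ 3 * (R₁ * r) * M₁ := le_trans (by positivity) (hbox ⟨0, by omega⟩)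
  have hprod : 2 * (l1 (rel y c.src) : ℝ) * (L ^ 2 * (g₀ * p)) ≤ 3 * (3 * (R₁ * r) * M₁) * (L ^ 2 * (g₀ * p)) :=
    mul_le_mul_of_nonneg_right hl hLg
  have hR' : 0 ≤ 3 * (R₁ * r) * M₁ * (L ^ 2 * (g₀ * p)) := mul_nonneg hR hLg
  have h := norm_B27T_le hlohi V hV y h13 (by linarith) h0 c hc hce (by linarith)
  exact ⟨by linarith, by linarith⟩

omit [CompleteSpace 𝔸] in
/-- A flat configuration near `□₁` (`V(∂p′) = 1` on the plaquettes of the box) has `B ≡ 0` there: the axial gauge gauges it to `1`.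
(degenerate instance α = 0 of (28); non-vacuity, no content of the series) [cite: Balaban1985UV3, (28) p.263] -/
theorem B27T_eq_zero_of_flat (hlohi : ∀ i, lo i ≤ hi i) (V : GaugeField P j 𝔸ˣ) (hV : ∀ b, V b ∈ U1 𝔸) (y : Site P j)
    (hflat : ∀ (z : LSite P.d) (κ μ : Fin P.d), κ ≠ μ → PlaqIn lo hi (z, κ, μ) →
      ((holT V (transl y z) (plaqWord κ μ) : 𝔸ˣ) : 𝔸) = 1)
    (h0 : InBox lo hi 0) (c : PBond P j) (hc : InBox lo hi (rel y c.src)) (hce : InBox lo hi (rel y c.src + e c.dir)) :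
    B27T V y c = 0 := by
  have h := norm_holT_contourT_sub_one_le hlohi V hV y (α := 0)
    (fun z κ μ hne hp => by rw [hflat z κ μ hne hp, sub_self, norm_zero]) le_rfl h0 c hc hce
  rw [mul_zero] at h
  have h1 : ((holT V y (contourT y c) : 𝔸ˣ) : 𝔸) = 1 := by
    rw [← sub_eq_zero]; exact norm_le_zero_iff.mp h
  rw [B27T_eq, h1, mlog_one, smul_zero]

end Bound28

/-! ## §5 Unitary-valued configurations on the torus: `B(c)` is self-adjoint, `exp iB(c)` is unitary -/

section Unitary

variable {P : Params} {j : ℕ} {𝔸 : Type*} [CStarAlgebra 𝔸] {lo hi : LSite P.d}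

/-- The contour holonomy of (27) of a unitary-valued torus configuration is unitary. (the unitary model of (27); elementary) [cite: Balaban1985UV3, (27) p.263] -/
theorem holT_contourT_mem_unitary {V : GaugeField P j 𝔸ˣ} (hV : ∀ b, V b ∈ unitaryUnits 𝔸) (y : Site P j) (c : PBond P j) :
    ((holT V y (contourT y c) : 𝔸ˣ) : 𝔸) ∈ unitary 𝔸 := by
  rw [← hol_pull_zero]
  exact mem_unitaryUnits.mp (hol_mem_of (V := pull V y) (fun z κ => hV _) 0 _)

variable [Nontrivial 𝔸]

/-- Unitary-valued torus configurations are norm-one-unit valued. (the unitary model of (27); elementary) [cite: Balaban1985UV3, (27) p.263] -/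
theorem U1_of_unitaryUnits {V : GaugeField P j 𝔸ˣ} (hV : ∀ b, V b ∈ unitaryUnits 𝔸) : ∀ b, V b ∈ U1 𝔸 :=
  fun b => unitaryUnits_le_U1 (hV b)

/-- `iB(c) = log V(Γ_{y,c₋} ∪ c ∪ Γ_{c₊,y})` is SKEW-ADJOINT for unitary-valued `V` on every bond of the box with `|c₋ − y|₁·α ≤ ¼`
(b07's `star_mlog_eq_neg`). (the unitary model of (27); elementary) [cite: Balaban1985UV3, (27) p.263] -/
theorem I_smul_B27T_mem_skewAdjoint (hlohi : ∀ i, lo i ≤ hi i) {V : GaugeField P j 𝔸ˣ} (hV : ∀ b, V b ∈ unitaryUnits 𝔸)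
    (y : Site P j) {α : ℝ}
    (h13 : ∀ (z : LSite P.d) (κ μ : Fin P.d), κ ≠ μ → PlaqIn lo hi (z, κ, μ) →
      ‖((holT V (transl y z) (plaqWord κ μ) : 𝔸ˣ) : 𝔸) - 1‖ ≤ α)
    (hα : 0 ≤ α) (h0 : InBox lo hi 0) (c : PBond P j) (hc : InBox lo hi (rel y c.src))
    (hce : InBox lo hi (rel y c.src + e c.dir)) (hsmall : (l1 (rel y c.src) : ℝ) * α ≤ 1 / 4) :
    Complex.I • B27T V y c ∈ skewAdjoint 𝔸 := by
  rw [skewAdjoint.mem_iff, I_smul_B27T]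
  exact star_mlog_eq_neg (holT_contourT_mem_unitary hV y c)
    ((norm_holT_contourT_sub_one_le hlohi V (U1_of_unitaryUnits hV) y h13 hα h0 c hc hce).trans hsmall)

/-- **`B(c)` is self-adjoint** — the `𝔤`-valuedness of (27) in the `U(𝔸)` model — on every bond of the box with `|c₋ − y|₁·α ≤ ¼`.
[cite: Balaban1985UV3, (27) p.263] -/
theorem B27T_mem_selfAdjoint (hlohi : ∀ i, lo i ≤ hi i) {V : GaugeField P j 𝔸ˣ} (hV : ∀ b, V b ∈ unitaryUnits 𝔸)
    (y : Site P j) {α : ℝ}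
    (h13 : ∀ (z : LSite P.d) (κ μ : Fin P.d), κ ≠ μ → PlaqIn lo hi (z, κ, μ) →
      ‖((holT V (transl y z) (plaqWord κ μ) : 𝔸ˣ) : 𝔸) - 1‖ ≤ α)
    (hα : 0 ≤ α) (h0 : InBox lo hi 0) (c : PBond P j) (hc : InBox lo hi (rel y c.src))
    (hce : InBox lo hi (rel y c.src + e c.dir)) (hsmall : (l1 (rel y c.src) : ℝ) * α ≤ 1 / 4) :
    B27T V y c ∈ selfAdjoint 𝔸 := by
  have h := I_smul_B27T_mem_skewAdjoint hlohi hV y h13 hα h0 c hc hce hsmall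
  rw [skewAdjoint.mem_iff, star_smul, Complex.star_def, Complex.conj_I, ← neg_smul] at h
  exact (selfAdjoint.mem_iff).mpr (smul_right_injective 𝔸 (neg_ne_zero.mpr Complex.I_ne_zero) h)

/-- `exp(iB(c))` is unitary (it IS the contour holonomy) on every bond of the box with `|c₋ − y|₁·α < 1`. (the unitary model of (27); elementary)
[cite: Balaban1985UV3, (27) p.263] -/
theorem exp_I_smul_B27T_mem_unitary (hlohi : ∀ i, lo i ≤ hi i) {V : GaugeField P j 𝔸ˣ} (hV : ∀ b, V b ∈ unitaryUnits 𝔸)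
    (y : Site P j) {α : ℝ}
    (h13 : ∀ (z : LSite P.d) (κ μ : Fin P.d), κ ≠ μ → PlaqIn lo hi (z, κ, μ) →
      ‖((holT V (transl y z) (plaqWord κ μ) : 𝔸ˣ) : 𝔸) - 1‖ ≤ α)
    (hα : 0 ≤ α) (h0 : InBox lo hi 0) (c : PBond P j) (hc : InBox lo hi (rel y c.src))
    (hce : InBox lo hi (rel y c.src + e c.dir)) (hlt : (l1 (rel y c.src) : ℝ) * α < 1) :
    exp (Complex.I • B27T V y c) ∈ unitary 𝔸 := by
  rw [exp_I_smul_B27T_of_plaq hlohi V (U1_of_unitaryUnits hV) y h13 hα h0 c hc hce hlt]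
  exact holT_contourT_mem_unitary hV y c

end Unitary

/-! ## §6 The reading for `G = U(N)`: (13) in the cell's letters `dist1 (plaqHol V p′) ≤ 2L²g₀p(g₀)` -/

section Hom

variable {P : Params} {j : ℕ} {G H : Type*} [Group G] [Group H]

/-- Torus transport is natural in the group: a homomorphism `φ` maps `V(Γ)` to `(φ ∘ V)(Γ)`. (bookkeeping of (9), no content of the series) [cite:
Balaban1985Averaging, (9) p.19] -/
theorem holT_map (φ : G →* H) (V : GaugeField P j G) : ∀ (x : Site P j) (w : List (Letter P.d)),
    holT (fun b => φ (V b)) x w = φ (holT V x w)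
  | x, [] => by rw [holT_nil, holT_nil, map_one]
  | x, (μ, true) :: w => by rw [holT_cons_true, holT_cons_true, map_mul, holT_map φ V (x.shift μ) w]
  | x, (μ, false) :: w => by rw [holT_cons_false, holT_cons_false, map_mul, map_inv, holT_map φ V (x.unshift μ) w]

/-- The reversed plaquette word is the plaquette word with the axes exchanged. (bookkeeping of (9), no content of the series) [cite: Balaban1985Averaging, (9) p.19] -/
theorem revWord_plaqWord {d : ℕ} (κ μ : Fin d) : revWord (plaqWord μ κ) = plaqWord κ μ := by
  simp [plaqWord, revWord]

/-- Exchanging the axes inverts the plaquette holonomy: `V(∂(x; κ, μ)) = V(∂(x; μ, κ))⁻¹`. [cite: Balaban1985Averaging, (9) p.19] -/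
theorem holT_plaqWord_swap (V : GaugeField P j G) (x : Site P j) (κ μ : Fin P.d) :
    holT V x (plaqWord κ μ) = (holT V x (plaqWord μ κ))⁻¹ := by
  rw [← hol_pull_zero, ← hol_pull_zero, ← revWord_plaqWord,
    B7Prop1Explicit.hol_revWord' (pull V x) 0 (plaqWord μ κ) (by rw [B7Prop1Explicit.disp_plaqWord, add_zero])]

end Hom

section UnitaryMatrix

open scoped Matrix.Norms.L2Operator

variable {P : Params} {j : ℕ} {N : ℕ}

/-- A `U(N)`-valued torus configuration (the cell's gauge group `Matrix.unitaryGroup (Fin N) ℂ` with `dist1 W = ‖W − 1‖_op`,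
`UnitaryModel.instGaugeGroupUnitaryGroup`) read in the units of `M_N(ℂ)` — the carrier of the Banach-algebra statements above.
(bookkeeping of the U(N) model of [Balaban1985Averaging] (19), no content of the series) [cite: Balaban1985Averaging, (19) p.21] -/
def unitsField (U : GaugeField P j (Matrix.unitaryGroup (Fin N) ℂ)) : GaugeField P j (Matrix (Fin N) (Fin N) ℂ)ˣ :=
  fun b => Unitary.toUnits (U b)

/-- Its bond variables are the same matrices. (bookkeeping of the U(N) model of [Balaban1985Averaging] (19), no content of the series) [cite:
Balaban1985Averaging, (19) p.21] -/
@[simp] theorem val_unitsField (U : GaugeField P j (Matrix.unitaryGroup (Fin N) ℂ)) (b : PBond P j) :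
    ((unitsField U b : (Matrix (Fin N) (Fin N) ℂ)ˣ) : Matrix (Fin N) (Fin N) ℂ) = ((U b : Matrix.unitaryGroup (Fin N) ℂ) : _) := rfl

/-- It is unitary-valued. (bookkeeping of the U(N) model of [Balaban1985Averaging] (19), no content of the series) [cite: Balaban1985Averaging, (19) p.21] -/
theorem unitsField_mem_unitaryUnits (U : GaugeField P j (Matrix.unitaryGroup (Fin N) ℂ)) (b : PBond P j) :
    unitsField U b ∈ unitaryUnits (Matrix (Fin N) (Fin N) ℂ) :=
  mem_unitaryUnits.mpr (U b).2

/-- Its transports are the same matrices as the cell's `U(N)`-valued transports. (bookkeeping of the U(N) model of [Balaban1985Averaging] (19), no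
content of the series) [cite: Balaban1985Averaging, (19) p.21] -/
theorem val_holT_unitsField (U : GaugeField P j (Matrix.unitaryGroup (Fin N) ℂ)) (x : Site P j) (w : List (Letter P.d)) :
    ((holT (unitsField U) x w : (Matrix (Fin N) (Fin N) ℂ)ˣ) : Matrix (Fin N) (Fin N) ℂ) =
      ((holT U x w : Matrix.unitaryGroup (Fin N) ℂ) : Matrix (Fin N) (Fin N) ℂ) := by
  have h : unitsField U = fun b => Unitary.toUnits (U b) := rfl
  rw [h, holT_map]; rfl

variable [NeZero N]

/-- **(13) in the cell's letters IS the plaquette hypothesis of §4**: `‖V♯(∂(y + z; κ, μ)) − 1‖ = dist1 (plaqHol V p′)`, `p′ = ⟨y + z; κ < μ⟩`,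
for the cell's `U(N)` (`dist1 W = ‖W − 1‖_op`). [cite: Balaban1985UV3, (13) p.259] -/
theorem norm_holT_unitsField_plaqWord_sub_one (U : GaugeField P j (Matrix.unitaryGroup (Fin N) ℂ)) (x : Site P j)
    {κ μ : Fin P.d} (h : κ < μ) :
    ‖((holT (unitsField U) x (plaqWord κ μ) : (Matrix (Fin N) (Fin N) ℂ)ˣ) : Matrix (Fin N) (Fin N) ℂ) - 1‖ =
      dist1 (GaugeField.plaqHol U ⟨x, κ, μ, h⟩) := by
  rw [val_holT_unitsField, holT_plaqWord_eq_plaqHol U ⟨x, κ, μ, h⟩]; rfl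

/-- The plaquette hypothesis of §4 for BOTH orientations from (13) on the positively oriented plaquettes `p′ = ⟨y + z; κ < μ⟩` of the box
(the other orientation is the inverse holonomy, whose distance to `1` is not larger for unitaries). [cite: Balaban1985UV3, (13) p.259] -/
theorem h13_unitsField {lo hi : LSite P.d} (U : GaugeField P j (Matrix.unitaryGroup (Fin N) ℂ)) (y : Site P j) {α : ℝ}
    (h13 : ∀ (z : LSite P.d) (κ μ : Fin P.d) (hκμ : κ < μ), PlaqIn lo hi (z, κ, μ) →
      dist1 (GaugeField.plaqHol U ⟨transl y z, κ, μ, hκμ⟩) ≤ α) :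
    ∀ (z : LSite P.d) (κ μ : Fin P.d), κ ≠ μ → PlaqIn lo hi (z, κ, μ) →
      ‖((holT (unitsField U) (transl y z) (plaqWord κ μ) : (Matrix (Fin N) (Fin N) ℂ)ˣ) : Matrix (Fin N) (Fin N) ℂ) - 1‖ ≤ α := by
  letI : CStarAlgebra (Matrix (Fin N) (Fin N) ℂ) := B10Eq29TubeLine.cstarAlgebraMatrix N
  intro z κ μ hne hp
  rcases lt_or_gt_of_ne hne with hlt | hgt
  · rw [norm_holT_unitsField_plaqWord_sub_one U _ hlt]; exact h13 z κ μ hlt hp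
  · have hp' : PlaqIn lo hi (z, μ, κ) := ⟨hp.1, by simpa [add_right_comm] using hp.2⟩
    have hmem : holT (unitsField U) (transl y z) (plaqWord μ κ) ∈ unitaryUnits (Matrix (Fin N) (Fin N) ℂ) := by
      rw [← hol_pull_zero]; exact hol_mem_of (V := pull (unitsField U) (transl y z)) (fun _ _ => unitsField_mem_unitaryUnits U _) 0 _
    rw [holT_plaqWord_swap]
    exact (B7Prop1Explicit.norm_inv_sub_one_le (unitaryUnits_le_U1 hmem)).trans
      (by rw [norm_holT_unitsField_plaqWord_sub_one U _ hgt]; exact h13 z μ κ hgt hp')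

/-- **(27)–(28) FOR THE CELL'S `U(N)`-VALUED TORUS CONFIGURATIONS UNDER (13) AS TYPED IN THE CELL** (`dist1 (plaqHol V p′) ≤ 2L²g₀p(g₀)`
— the letters of `Setup.PlaqSmallOn` / B10's `chiSmall`, `B10Eq2DensityTower.chi4`) on the plaquettes near `□₁` (`d = 3`): both members of (28)
for `B(c) = (1/i) log V(Γ_{y,c₋} ∪ c ∪ Γ_{c₊,y})`, which is moreover a HERMITIAN matrix (`𝔲(N)`-valuedness of `iB`) as soon as the first member
is `≤ ½` (`|c₋ − y|₁·2L²g₀p(g₀) ≤ ¼`). [cite: Balaban1985UV3, (27)–(28) p.263, (13) p.259] -/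
theorem eq28T_unitaryGroup (hd : P.d = 3) {lo hi : LSite P.d} (hlohi : ∀ i, lo i ≤ hi i)
    (U : GaugeField P j (Matrix.unitaryGroup (Fin N) ℂ)) (y : Site P j) {L g₀ p R₁ r M₁ : ℝ} (hgp : 0 ≤ g₀ * p)
    (h13 : ∀ (z : LSite P.d) (κ μ : Fin P.d) (hκμ : κ < μ), PlaqIn lo hi (z, κ, μ) →
      dist1 (GaugeField.plaqHol U ⟨transl y z, κ, μ, hκμ⟩) ≤ 2 * L ^ 2 * (g₀ * p))
    (h0 : InBox lo hi 0) (c : PBond P j) (hc : InBox lo hi (rel y c.src)) (hce : InBox lo hi (rel y c.src + e c.dir))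
    (hbox : ∀ κ, 2 * (((rel y c.src) κ).natAbs : ℝ) ≤ 3 * (R₁ * r) * M₁)
    (hsmall : 8 * L ^ 2 * (3 * R₁ * M₁ * r) * (g₀ * p) ≤ 1) :
    ‖B27T (unitsField U) y c‖ ≤ 4 * L ^ 2 * l1 (rel y c.src) * (g₀ * p) ∧
      4 * L ^ 2 * (l1 (rel y c.src) : ℝ) * (g₀ * p) ≤ 8 * L ^ 2 * (3 * R₁ * M₁ * r) * (g₀ * p) ∧
      ((l1 (rel y c.src) : ℝ) * (2 * L ^ 2 * (g₀ * p)) ≤ 1 / 4 →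
        B27T (unitsField U) y c ∈ selfAdjoint (Matrix (Fin N) (Fin N) ℂ)) := by
  letI : CStarAlgebra (Matrix (Fin N) (Fin N) ℂ) := B10Eq29TubeLine.cstarAlgebraMatrix N
  have hU : ∀ b, unitsField U b ∈ unitaryUnits (Matrix (Fin N) (Fin N) ℂ) := unitsField_mem_unitaryUnits U
  have h13' := h13_unitsField U y h13
  have h28 := eq28T_print hd hlohi (unitsField U) (U1_of_unitaryUnits hU) y hgp h13' h0 c hc hce hbox hsmall
  exact ⟨h28.1, h28.2, fun hq =>
    B27T_mem_selfAdjoint hlohi hU y h13' (by positivity) h0 c hc hce hq⟩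

end UnitaryMatrix

/-! ## §7 Non-vacuity: the trivial configuration -/

section Trivial

variable {P : Params} {j : ℕ}

/-- Every transport of the trivial configuration `V ≡ 1` is `1`. (non-vacuity instance, no content of the series) [cite: Balaban1985UV3, (27) p.263] -/
theorem holT_one {G : Type*} [Group G] : ∀ (x : Site P j) (w : List (Letter P.d)),
    holT (fun _ : PBond P j => (1 : G)) x w = 1
  | x, [] => rfl
  | x, (μ, true) :: w => by rw [holT_cons_true, holT_one (x.shift μ) w, one_mul]
  | x, (μ, false) :: w => by rw [holT_cons_false, holT_one (x.unshift μ) w, inv_one, one_mul]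

variable {𝔸 : Type*} [NormedRing 𝔸] [NormedAlgebra ℂ 𝔸]

/-- (27) of the trivial configuration vanishes at every bond (its axial gauge is `1`): the objects of this file are inhabited and the
bound (28) is met with room to spare. (non-vacuity instance, no content of the series) [cite: Balaban1985UV3, (27) p.263] -/
theorem B27T_one (y : Site P j) (c : PBond P j) : B27T (fun _ : PBond P j => (1 : 𝔸ˣ)) y c = 0 := by
  rw [B27T_eq, holT_one, Units.val_one, mlog_one, smul_zero]

end Trivial

/-! ## §8 (v1.1) The semi-simple model `G = SU(N)` of Theorem 1 (p. 257 «a semi-simple compact group Lie G»): read through `SU(N) ≤ U(N)`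

HONEST SCOPE (i) of v1 left the `SU(N)`-valued fields to «the inclusion (not spelled out)»; this section spells it out: the inclusion
homomorphism `suIncl`, the included field `toUField U`, the identity of the (13) letters (`dist1` of the cell's `SU(N)` instance = `dist1` of the
included plaquette variable, both `‖W − 1‖_op`), and (27)–(28) for `SU(N)`-valued torus configurations (`eq28T_specialUnitaryGroup`). -/

section SpecialUnitaryMatrix

open scoped Matrix.Norms.L2Operator

variable {P : Params} {j : ℕ} {N : ℕ}

/-- The inclusion `SU(N) ≤ U(N)` as a homomorphism (`Submonoid.inclusion`). (bookkeeping of the U(N) model of [Balaban1985Averaging] (19), no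
content of the series) [cite: Balaban1985Averaging, (19) p.21] -/
def suIncl : Matrix.specialUnitaryGroup (Fin N) ℂ →* Matrix.unitaryGroup (Fin N) ℂ :=
  Submonoid.inclusion Matrix.specialUnitaryGroup_le_unitaryGroup

/-- The inclusion does not change the matrix. (bookkeeping of the U(N) model of [Balaban1985Averaging] (19), no content of the series)
[cite: Balaban1985Averaging, (19) p.21] -/
@[simp] theorem val_suIncl (g : Matrix.specialUnitaryGroup (Fin N) ℂ) :
    ((suIncl g : Matrix.unitaryGroup (Fin N) ℂ) : Matrix (Fin N) (Fin N) ℂ) = (g : Matrix (Fin N) (Fin N) ℂ) := rfl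

/-- An `SU(N)`-valued torus configuration read as a `U(N)`-valued one. (bookkeeping of the U(N) model of [Balaban1985Averaging] (19), no content
of the series) [cite: Balaban1985Averaging, (19) p.21] -/
def toUField (U : GaugeField P j (Matrix.specialUnitaryGroup (Fin N) ℂ)) : GaugeField P j (Matrix.unitaryGroup (Fin N) ℂ) :=
  fun b => suIncl (U b)

/-- Its transports are the included `SU(N)` transports. (bookkeeping of (9), no content of the series) [cite: Balaban1985Averaging, (9) p.19] -/
theorem holT_toUField (U : GaugeField P j (Matrix.specialUnitaryGroup (Fin N) ℂ)) (x : Site P j) (w : List (Letter P.d)) :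
    holT (toUField U) x w = suIncl (holT U x w) :=
  holT_map suIncl U x w

variable [NeZero N]

/-- Its plaquette variables are the included `SU(N)` plaquette variables. (bookkeeping of (9), no content of the series)
[cite: Balaban1985Averaging, (9) p.19] -/
theorem plaqHol_toUField (U : GaugeField P j (Matrix.specialUnitaryGroup (Fin N) ℂ)) (p : Plaq P j) :
    GaugeField.plaqHol (toUField U) p = suIncl (GaugeField.plaqHol U p) := by
  rw [← holT_plaqWord_eq_plaqHol, ← holT_plaqWord_eq_plaqHol, holT_toUField]

/-- (13) reads the same in `SU(N)` and in `U(N)`: `dist1` of the cell's `SU(N)` instance (`UnitaryModel.instGaugeGroupSpecialUnitaryGroup`,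
`dist1 W = ‖W − 1‖_op` through the fundamental representation) is `dist1` of the included plaquette variable. [cite: Balaban1985UV3, (13) p.259] -/
theorem dist1_plaqHol_toUField (U : GaugeField P j (Matrix.specialUnitaryGroup (Fin N) ℂ)) (p : Plaq P j) :
    dist1 (GaugeField.plaqHol (toUField U) p) = dist1 (GaugeField.plaqHol U p) := by
  rw [plaqHol_toUField]; rfl

/-- **(27)–(28) FOR THE CELL'S `SU(N)`-VALUED TORUS CONFIGURATIONS** — the semi-simple model of Theorem 1 — under (13) as typed in the cell
(`dist1 (plaqHol V p′) ≤ 2L²g₀p(g₀)` on the plaquettes near `□₁`, `d = 3`): both members of (28) for `B(c)` of (27) (read in `M_N(ℂ)` through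
`SU(N) ≤ U(N)`), and `B(c)` Hermitian as soon as `|c₋ − y|₁·2L²g₀p(g₀) ≤ ¼` (`eq28T_unitaryGroup` at the included field).
[cite: Balaban1985UV3, (27)–(28) p.263, (13) p.259, Thm 1 p.257] -/
theorem eq28T_specialUnitaryGroup (hd : P.d = 3) {lo hi : LSite P.d} (hlohi : ∀ i, lo i ≤ hi i)
    (U : GaugeField P j (Matrix.specialUnitaryGroup (Fin N) ℂ)) (y : Site P j) {L g₀ p R₁ r M₁ : ℝ} (hgp : 0 ≤ g₀ * p)
    (h13 : ∀ (z : LSite P.d) (κ μ : Fin P.d) (hκμ : κ < μ), PlaqIn lo hi (z, κ, μ) →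
      dist1 (GaugeField.plaqHol U ⟨transl y z, κ, μ, hκμ⟩) ≤ 2 * L ^ 2 * (g₀ * p))
    (h0 : InBox lo hi 0) (c : PBond P j) (hc : InBox lo hi (rel y c.src)) (hce : InBox lo hi (rel y c.src + e c.dir))
    (hbox : ∀ κ, 2 * (((rel y c.src) κ).natAbs : ℝ) ≤ 3 * (R₁ * r) * M₁)
    (hsmall : 8 * L ^ 2 * (3 * R₁ * M₁ * r) * (g₀ * p) ≤ 1) :
    ‖B27T (unitsField (toUField U)) y c‖ ≤ 4 * L ^ 2 * l1 (rel y c.src) * (g₀ * p) ∧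
      4 * L ^ 2 * (l1 (rel y c.src) : ℝ) * (g₀ * p) ≤ 8 * L ^ 2 * (3 * R₁ * M₁ * r) * (g₀ * p) ∧
      ((l1 (rel y c.src) : ℝ) * (2 * L ^ 2 * (g₀ * p)) ≤ 1 / 4 →
        B27T (unitsField (toUField U)) y c ∈ selfAdjoint (Matrix (Fin N) (Fin N) ℂ)) :=
  eq28T_unitaryGroup hd hlohi (toUField U) y hgp
    (fun z κ μ hκμ hp => by rw [dist1_plaqHol_toUField]; exact h13 z κ μ hκμ hp) h0 c hc hce hbox hsmall

end SpecialUnitaryMatrix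

end Literature.MathematicalPhysics.QuantumFieldTheory.Balaban1983to89.B10Eq27TorusAxialLog

end
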